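import Mathlib
import Summits.NavierStokesRegularity.FluidComputer.AbcInertiaEigenvalues
import Literature.Analysis.OperatorTheory.BandedFirstOrderEigenvectorRegularity

/-!
# INERTIA-3L instantiation, Part 10: FORM-DOMAIN eigenvectors are rapidly decaying — the count holds for
# the point spectrum of the class-II operator on its form domain (instab3 g8, cell `ns-blowup`, 2026-08-27)

HONEST FRAMING (human ruling D-0035): nothing here is a claim about Navier–Stokes blow-up.
WHAT THIS IS NOT: not NS evidence. MODEL lane (forced-ABC linearisation, class II, coordinates of
`AbcClassIIDefs`); no certificate, number or census word moves.

`AbcInertiaEigenvalues.card_eigenpairs_le` counts RAPIDLY DECAYING coordinate eigenvectors. By the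
Literature bootstrap `FirstOrderBand.summable_weighted_of_eigen` (interior elliptic regularity in Fourier
coefficients, Evans §6.3.1; instab4's X0 chain uses the same lemma), every coordinate eigenvector of the
class-II operator `(L x)_i = −(|O_i|²/R) x_i + Σ_{j ∈ nbrIdx i} amat i j x_j` (`R ≥ 1`) lying in the FORM
DOMAIN `Σ (1 + |O_i|²)|x_i|² < ∞` is rapidly decaying (`rapid_of_formDomain_eigen`: band `nbrIdx` of width
`≤ 288²`, symmetric; growth `|amat i j| ≤ 2592 √(1+|O_j|²) ≤ 2592√R · w_j` with `w_j = √(1 + |O_j|²/R)`;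
comparable weights `AbcClassIIIndex.one_add_onormSq_le_of_mem_nbrIdx`; Hilbert basis = the coordinate
basis of `ℓ²(Idx, ℂ)`). Hence **`card_formDomain_eigenpairs_le`**: given the INERTIA-3L count `hcount` of a
cell `(R, a, m)`, `n` form-domain eigenvectors with pairwise distinct eigenvalues of real part `≥ a` ⇒
`n ≤ m` — the count is a statement about the POINT SPECTRUM of the class-II operator (domain `H² ⊂` form
domain `H¹`), not only about smooth eigenfunctions.

Mathlib + `AbcInertiaEigenvalues` + `Literature…BandedFirstOrderEigenvectorRegularity`; no new definitions;
std axioms. [folklore]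
-/

noncomputable section

open scoped BigOperators ComplexConjugate InnerProductSpace lp
open Finset

namespace Summit.NavierStokesRegularity.FluidComputer.AbcInertia

open Literature.Analysis.FunctionSpaces Literature.Analysis.FunctionSpaces.Torus
open Literature.Analysis.FluidPDE
open Summit.NavierStokesRegularity.FluidComputer.AbcClassII

/-- **Form-domain eigenvectors of the class-II coordinate operator are rapidly decaying** (`R ≥ 1`). -/
theorem rapid_of_formDomain_eigen {R : ℝ} (hR : 1 ≤ R) (μ : ℂ) {x : Idx → ℂ}
    (hx1 : Summable fun i : Idx => (1 + onormSq i.1) * ‖x i‖ ^ 2)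
    (heig : ∀ i : Idx, ((-(onormSq i.1 / R) : ℝ) : ℂ) * x i + ∑ j ∈ nbrIdx i, ((amat i j : ℝ) : ℂ) * x j =
      μ * x i) (s : ℕ) :
    Summable fun i : Idx => (1 + onormSq i.1) ^ s * ‖x i‖ ^ 2 := by
  classical
  have hR0 : 0 < R := by linarith
  -- the coordinate vector as an element of ℓ² and the coordinate Hilbert basis
  have hx0 : Summable fun i : Idx => ‖x i‖ ^ 2 := summable_norm_sq_of_weighted hx1
  set f : ℓ²(Idx, ℂ) := ⟨x, memℓp_two_of_summable_sq hx0⟩ with hf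
  set b : HilbertBasis Idx ℂ ℓ²(Idx, ℂ) := HilbertBasis.ofRepr (LinearIsometryEquiv.refl ℂ ℓ²(Idx, ℂ)) with hb
  have hcoef : ∀ i : Idx, ⟪b i, f⟫_ℂ = x i := by
    intro i
    rw [← b.repr_apply_apply]
    rfl
  -- weights, levels, growth constants
  set w : Idx → ℝ := fun i => Real.sqrt (1 + onormSq i.1 / R) with hw
  set ℓ : Idx → ℝ := fun i => -(onormSq i.1 / R) with hℓ
  have hq : ∀ i : Idx, 0 ≤ onormSq i.1 / R := fun i => div_nonneg (onormSq_nonneg i.1) hR0.le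
  have hw0 : ∀ i, 0 ≤ w i := fun i => Real.sqrt_nonneg _
  have hwsq : ∀ i, w i ^ 2 = 1 + onormSq i.1 / R := fun i => Real.sq_sqrt (by linarith [hq i])
  have hwℓ : ∀ i, w i ^ 2 ≤ 1 + |ℓ i| := by
    intro i; rw [hwsq, hℓ]; simp only [abs_neg, abs_of_nonneg (hq i)]; exact le_rfl
  -- growth: `|amat i j| ≤ 2592 √R · w_j`
  have hgrowth : ∀ i j : Idx, j ∈ nbrIdx i → ‖((amat i j : ℝ) : ℂ)‖ ≤ 2592 * Real.sqrt R * w j := by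
    intro i j _
    rw [Complex.norm_real, Real.norm_eq_abs]
    refine (abs_amat_le i j).trans ?_
    have h1 : Real.sqrt (1 + onormSq j.1) ≤ Real.sqrt R * w j := by
      rw [hw, ← Real.sqrt_mul hR0.le]
      refine Real.sqrt_le_sqrt ?_
      have := onormSq_nonneg j.1
      have e : R * (1 + onormSq j.1 / R) = R + onormSq j.1 := by field_simp
      rw [e]; linarith
    nlinarith [Real.sqrt_nonneg (1 + onormSq j.1)]
  -- comparable weights along the band
  have hL : ∀ i j : Idx, j ∈ nbrIdx i → w i ≤ Real.sqrt (2 * (1 + R⁻¹)) * w j := by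
    intro i j hij
    rw [hw, ← Real.sqrt_mul (by positivity)]
    exact Real.sqrt_le_sqrt (one_add_onormSq_le_of_mem_nbrIdx hR0 hij)
  -- the eigen-equation in the Hilbert-basis coordinates
  have heig' : ∀ i : Idx, (ℓ i : ℂ) * ⟪b i, f⟫_ℂ + ∑ j ∈ nbrIdx i, ((amat i j : ℝ) : ℂ) * ⟪b j, f⟫_ℂ =
      μ * ⟪b i, f⟫_ℂ := by
    intro i
    simp only [hcoef]
    exact heig i
  -- the form-level energy
  have h1 : Summable fun i : Idx => w i ^ 2 * ‖⟪b i, f⟫_ℂ‖ ^ 2 := by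
    refine Summable.of_nonneg_of_le (fun i => mul_nonneg (sq_nonneg _) (sq_nonneg _)) (fun i => ?_) hx1
    rw [hcoef, hwsq]
    have : onormSq i.1 / R ≤ onormSq i.1 := div_le_self (onormSq_nonneg i.1) hR
    exact mul_le_mul_of_nonneg_right (by linarith) (sq_nonneg _)
  -- the bootstrap
  have hboot := Literature.Analysis.OperatorTheory.FirstOrderBand.summable_weighted_of_eigen (e := b)
    (w := w) (ℓ := ℓ) (nbr := nbrIdx) (a := fun i j => ((amat i j : ℝ) : ℂ)) (K := 2592 * Real.sqrt R)
    (L := Real.sqrt (2 * (1 + R⁻¹))) (W := 288 * 288) (f := f) (lam := μ)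
    hw0 hwℓ (by positivity) hgrowth (fun i j => mem_nbrIdx_comm i j) (fun i => card_nbrIdx_le i)
    (Real.sqrt_nonneg _) hL heig' h1 s
  -- back to the weights `(1 + |O|²)^s ≤ R^s (1 + |O|²/R)^s`
  refine Summable.of_nonneg_of_le (fun i => mul_nonneg (pow_nonneg (by linarith [onormSq_nonneg i.1]) _)
    (sq_nonneg _)) (fun i => ?_) (hboot.mul_left (R ^ s))
  rw [hcoef, pow_mul, hwsq, ← mul_assoc, ← mul_pow]
  refine mul_le_mul_of_nonneg_right (pow_le_pow_left₀ (by linarith [onormSq_nonneg i.1]) ?_ s) (sq_nonneg _)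
  have e : R * (1 + onormSq i.1 / R) = R + onormSq i.1 := by field_simp
  rw [e]; linarith

/-- **The count on the form domain.** Given the INERTIA-3L count `hcount` for the cell `(R, a, m)`
(`R ≥ 1`): `n` coordinate eigenvectors in the form domain `Σ(1+|O_i|²)|x_i|² < ∞` with pairwise distinct
eigenvalues of real part `≥ a` ⇒ `n ≤ m`. -/
theorem card_formDomain_eigenpairs_le {R a : ℝ} {m : ℕ} (hR : 1 ≤ R)
    (hcount : ∀ (W : Submodule ℂ (Idx → ℂ)), FiniteDimensional ℂ W →
      (∀ x ∈ W, ∀ s : ℕ, Summable fun i : Idx => (1 + onormSq i.1) ^ s * ‖x i‖ ^ 2) →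
      (∀ x ∈ W, (fun i : Idx => ((-(onormSq i.1 / R) : ℝ) : ℂ) * x i +
        ∑ j ∈ nbrIdx i, ((amat i j : ℝ) : ℂ) * x j) ∈ W) →
      (∀ (μ : ℂ) (x : Idx → ℂ), x ∈ W → x ≠ 0 →
        (∀ i : Idx, ((-(onormSq i.1 / R) : ℝ) : ℂ) * x i + ∑ j ∈ nbrIdx i, ((amat i j : ℝ) : ℂ) * x j = μ * x i) →
        a ≤ μ.re) →
      Module.finrank ℂ W ≤ m)
    {n : ℕ} (μ : Fin n → ℂ) (hμ : Function.Injective μ) (x : Fin n → (Idx → ℂ))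
    (hx1 : ∀ k : Fin n, Summable fun i : Idx => (1 + onormSq i.1) * ‖x k i‖ ^ 2)
    (hx0 : ∀ k, x k ≠ 0)
    (heig : ∀ (k : Fin n) (i : Idx), ((-(onormSq i.1 / R) : ℝ) : ℂ) * x k i +
      ∑ j ∈ nbrIdx i, ((amat i j : ℝ) : ℂ) * x k j = μ k * x k i)
    (hre : ∀ k, a ≤ (μ k).re) : n ≤ m :=
  card_eigenpairs_le hcount μ hμ x (fun k s => rapid_of_formDomain_eigen hR (μ k) (hx1 k) (heig k) s)
    hx0 heig hre

end Summit.NavierStokesRegularity.FluidComputer.AbcInertia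

end
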